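import Mathlib
import Summits.ValiantsHypothesis.ValiantsHypothesis.Theorems.DivisionGapZeroOneTransferPerIsolation
import Summits.ValiantsHypothesis.ValiantsHypothesis.Theorems.DivisionGapZeroOneTransferPerForms
import Summits.ValiantsHypothesis.ValiantsHypothesis.Theorems.DivisionGapPerDivisionHardStubJssContraction
import Summits.ValiantsHypothesis.ValiantsHypothesis.Theorems.DivisionGapZeroOneTransferCofactorChargingMonomialTop
import Literature.Computability.AlgebraicComplexity.RazElusiveGeneralProofs

/-!
# Crux `DivisionGap.ZeroOneTransfer` (stmt-ValiantsHypothesis-5066), line `charged-uncharged`, Part E-IV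
(lead c13): the H1 TRANSFER of rung E-II — COFACTORS OF THE PERMANENT WITH FEW MONOMIALS ARE HARD

Route DivisionGap's H1 (`PerDivisionHard`, crux 2; uncharged form `PerMultiplesHard`, crux 9 — the
per-instance of HrubesYehudayoff2021 Problem 2) asks that every nonzero monotone multiple `per_n · h` be
expensive.  Known rungs in the tree: `h` a monomial (JSS contraction), `deg h ≤ n - 6`
(`two_pow_le_complexity_perPoly_mul`), powers `per^M`.  This file adds the rung that the sibling
crux's Part E-II suggested: cofactors with FEW MONOMIALS, of ANY degree.

* `per_fewMonomials_lower_bound` — `∃ κ, ∀ n, ∀ h ≠ 0` with `2·#supp h + 4 ≤ n`: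
  `2^((n + 2 - 2·#supp h)/3) ≤ ((n+2)(L₊(per_n · h) + 3))^κ`.  Proof: torus WLOG inside the support
  (`stub_torusPer`), OFF-DIAGONAL rigidity (`stub_offDiag_rigid`: equal column margins + agreement off
  the diagonal ⇒ equal), lexicographic penalty isolation on `< #supp h` off-diagonal cells `F`
  (`stub_isolate_pred`), free bottom form `per_n[avoid F] · a x^û` (`stub_botComponent_avoid_perPoly`:
  the identity has penalty `0`; `stub_botComponent_eq_monomial_gen`), JSS contraction of `x^û`
  (`stub_jssContraction`), the projection `perKill` of the rows/columns touched by `F` (support = the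
  permanent of the complement, `stub_support_perKill_perAvoid`), Jerrum–Snir by support
  (`two_pow_le_complexity_of_support_eq_perPoly`).
* `perMultiplesHard_fewMonomials`, `perDivisionHard_fewMonomials` — the asymptotic forms in the shape of
  the two cruxes: for every `c`, for all large `n`, every nonzero `h` with `4·#supp h ≤ n` has
  `2^((log₂ n + c)^c) < L₊(per_n · h)` (and a fortiori `< L₊(per_n · h) + L₊(h)`).
[cite: JerrumSnir1982, §4.3 and Cor. 3.5] [cite: JuknaSeiwertSergeev2022, Lemma 2]
-/

noncomputable section

-- `Summit.ValiantsHypothesis.ValiantsHypothesis.…` is the tree's mandated single-conjunct layout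
-- (Sub = Summit), so the duplicated namespace component is intended.
set_option linter.dupNamespace false

namespace Summit.ValiantsHypothesis.ValiantsHypothesis.Theorems.DivisionGapZeroOneTransfer

open MvPolynomial
open Literature.Computability.AlgebraicComplexity
open Summit.ValiantsHypothesis.ValiantsHypothesis.Theorems.ZeroOneTransfer
open Summit.ValiantsHypothesis.ValiantsHypothesis.Theorems.PerDivisionHard.Negative
open scoped NNReal BigOperators


namespace PerFewMonomials

variable {n : ℕ}

/-- Rows and columns touched by a set of cells. [folklore] -/
theorem card_touched_le (F : Finset (Fin n × Fin n)) :
    (F.image Prod.fst ∪ F.image Prod.snd).card ≤ F.card + F.card :=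
  (Finset.card_union_le _ _).trans (add_le_add Finset.card_image_le Finset.card_image_le)

end PerFewMonomials

open PerFewMonomials

/-- **Rung E-IV (H1 transfer of E-II): COFACTORS OF THE PERMANENT WITH FEW MONOMIALS.**  For every
nonzero `h ∈ ℝ≥0[x_ij]` with `2 · #supp h + 4 ≤ n`:
`2^((n + 2 - 2·#supp h)/3) ≤ ((n + 2)(L₊(per_n · h) + 3))^κ` — whatever the DEGREE of `h`.  Torus WLOG
(P3), off-diagonal rigidity (P2), penalty isolation on `< #supp h` off-diagonal cells `F` (P1), free
bottom form `per_n[avoid F] · a x^û` (P4, P5), JSS contraction, `perKill` of the rows/columns touched by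
`F` (a projection; support = the permanent of the complement, P6), Jerrum–Snir by support.
[cite: JerrumSnir1982, §4.3 and Cor. 3.5] [cite: JuknaSeiwertSergeev2022, Lemma 2] -/
theorem per_fewMonomials_lower_bound : ∃ κ : ℕ, ∀ (n : ℕ) (h : MvPolynomial (Fin n × Fin n) ℝ≥0),
    h ≠ 0 → 2 * h.support.card + 4 ≤ n →
    2 ^ ((n + 2 - 2 * h.support.card) / 3) ≤
      ((n + 2) * (complexity (perPoly (Fin n) ℝ≥0 * h) + 3)) ^ κ := by
  obtain ⟨κ, hκ⟩ := DivisionGapPerDivisionHard.stub_jssContraction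
  refine ⟨κ, fun n h hh hK => ?_⟩
  classical
  obtain ⟨h₁, hh₁, hsupp, hmarg, hcx1⟩ := stub_torusPer n h hh
  have hrig : ∀ u ∈ h₁.support, ∀ u' ∈ h₁.support,
      (∀ e : Fin n × Fin n, e.1 ≠ e.2 → u e = u' e) → u = u' :=
    fun u hu u' hu' hoff => stub_offDiag_rigid n u u' (hmarg u hu u' hu').2 hoff
  obtain ⟨F, p, û, hû, hFcard, hFoff, hppos, hpzero, hmin⟩ :=
    stub_isolate_pred (Fin n × Fin n) (fun e => e.1 ≠ e.2) h₁.support (support_nonempty.2 hh₁) hrig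
  -- the bottom form of `per_n · h₁`
  set A : MvPolynomial (Fin n × Fin n) ℝ≥0 :=
    ∑ π ∈ (Finset.univ : Finset (Equiv.Perm (Fin n))).filter (fun π => ∀ i, (π i, i) ∉ F),
      monomial (permMonomial π) (1 : ℝ≥0) with hA
  have hbotP : ProjClosure.botComponent p (perPoly (Fin n) ℝ≥0) = A :=
    stub_botComponent_avoid_perPoly n F p hFoff hppos hpzero
  have hbotX : ProjClosure.botComponent p h₁ = monomial û (coeff û h₁) :=
    stub_botComponent_eq_monomial_gen (Fin n × Fin n) p h₁ û hû hmin
  have hbot : ProjClosure.botComponent p (perPoly (Fin n) ℝ≥0 * h₁) = A * monomial û (coeff û h₁) := by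
    rw [ProjClosure.botComponent_mul, hbotP, hbotX]
  have ha : coeff û h₁ ≠ 0 := mem_support_iff.1 hû
  have hcxA : complexity (monomial û (1 : ℝ≥0) * A) ≤ complexity (perPoly (Fin n) ℝ≥0 * h) + 1 :=
    calc complexity (monomial û (1 : ℝ≥0) * A) ≤ complexity (A * monomial û (coeff û h₁)) + 1 :=
          MonomialTop.complexity_monomial_one_mul_le A û ha
      _ ≤ complexity (perPoly (Fin n) ℝ≥0 * h₁) + 1 := by
          rw [← hbot]; exact Nat.add_le_add_right (ProjClosure.complexity_botComponent_le _ _) 1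
      _ ≤ complexity (perPoly (Fin n) ℝ≥0 * h) + 1 := Nat.add_le_add_right hcx1 1
  -- JSS strips the monomial
  have hjss : complexity A ≤ ((n + 2) * (complexity (monomial û (1 : ℝ≥0) * A) + 2)) ^ κ := hκ n A û
  -- kill the rows and columns touched by `F`
  set R : Finset (Fin n) := F.image Prod.fst ∪ F.image Prod.snd with hR
  have hRF : ∀ e ∈ F, e.1 ∈ R ∧ e.2 ∈ R := fun e he =>
    ⟨Finset.mem_union_left _ (Finset.mem_image_of_mem _ he),
      Finset.mem_union_right _ (Finset.mem_image_of_mem _ he)⟩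
  have hsuppK := stub_support_perKill_perAvoid n F R hFoff hRF
  have hRcard : R.card ≤ F.card + F.card := card_touched_le F
  have hKle : h₁.support.card ≤ h.support.card := Finset.card_le_card hsupp
  have hcardI : Fintype.card {a : Fin n // a ∉ R} = n - R.card := by
    rw [Fintype.card_subtype_compl, Fintype.card_fin, Fintype.card_coe]
  have h6 : 6 ≤ Fintype.card {a : Fin n // a ∉ R} := by rw [hcardI]; omega
  have hJS := two_pow_le_complexity_of_support_eq_perPoly h6 hsuppK
  rw [hcardI] at hJS
  have hproj : complexity (MvPolynomial.aeval (perKill R) A) ≤ complexity A :=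
    complexity_le_of_isProjection (isProjection_perKill R A)
  calc 2 ^ ((n + 2 - 2 * h.support.card) / 3) ≤ 2 ^ ((n - R.card) / 3) :=
        Nat.pow_le_pow_right two_pos (by omega)
    _ ≤ complexity (MvPolynomial.aeval (perKill R) A) := hJS
    _ ≤ complexity A := hproj
    _ ≤ ((n + 2) * (complexity (monomial û (1 : ℝ≥0) * A) + 2)) ^ κ := hjss
    _ ≤ ((n + 2) * (complexity (perPoly (Fin n) ℝ≥0 * h) + 3)) ^ κ :=
        Nat.pow_le_pow_left (Nat.mul_le_mul_left _ (by omega)) κ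


namespace PerFewMonomials

/-- Growth bookkeeping: for every `c, κ` there is `T` with `6κ(t + 4 + (t+c)^c) + 6 ≤ 2^t` for all
`t ≥ T`, `T ≥ 3`. [folklore] -/
theorem exists_T (c κ : ℕ) : ∃ T : ℕ, 3 ≤ T ∧ ∀ t ≥ T, 6 * κ * (t + 4 + (t + c) ^ c) + 6 ≤ 2 ^ t := by
  obtain ⟨T, hT⟩ := Literature.Computability.AlgebraicComplexity.eventually_mul_pow_lt_two_pow (c + 1)
    (6 * κ * (5 + (1 + c) ^ c) + 6)
  refine ⟨max T 3, le_max_right _ _, fun t ht => ?_⟩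
  have ht1 : 1 ≤ t := by omega
  have htT : T ≤ t := (le_max_left _ _).trans ht
  have key := hT t htT
  have h1 : t + 4 ≤ 5 * t ^ (c + 1) := by
    have : t ≤ t ^ (c + 1) := Nat.le_self_pow (by omega) t
    omega
  have h2 : (t + c) ^ c ≤ (1 + c) ^ c * t ^ (c + 1) := by
    calc (t + c) ^ c ≤ (t * (1 + c)) ^ c := Nat.pow_le_pow_left (by nlinarith) c
      _ = (1 + c) ^ c * t ^ c := by rw [mul_pow]; ring
      _ ≤ (1 + c) ^ c * t ^ (c + 1) :=
          Nat.mul_le_mul_left _ (Nat.pow_le_pow_right ht1 (by omega))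
  have h3 : 6 ≤ 6 * t ^ (c + 1) := by
    have : 1 ≤ t ^ (c + 1) := Nat.one_le_pow _ _ ht1
    omega
  calc 6 * κ * (t + 4 + (t + c) ^ c) + 6
      ≤ 6 * κ * (5 * t ^ (c + 1) + (1 + c) ^ c * t ^ (c + 1)) + 6 * t ^ (c + 1) := by
        have := Nat.mul_le_mul_left (6 * κ) (add_le_add h1 h2)
        omega
    _ = (6 * κ * (5 + (1 + c) ^ c) + 6) * t ^ (c + 1) := by ring
    _ ≤ 2 ^ t := key.le

end PerFewMonomials

/-- **`PerMultiplesHard` for cofactors with few monomials.**  For every `c` there is `n₀` such that for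
all `n ≥ n₀` every nonzero `h` with `4 · #supp h ≤ n` has `2^((log₂ n + c)^c) < L₊(per_n · h)` — whatever
the degree of `h` (HrubesYehudayoff2021 Problem 2 for per, restricted to few-nomial multipliers).
[cite: JerrumSnir1982, §4.3 and Cor. 3.5] [cite: JuknaSeiwertSergeev2022, Lemma 2] -/
theorem perMultiplesHard_fewMonomials : ∀ c : ℕ, ∃ n₀ : ℕ, ∀ n ≥ n₀,
    ∀ h : MvPolynomial (Fin n × Fin n) ℝ≥0, h ≠ 0 → 4 * h.support.card ≤ n →
      2 ^ ((Nat.log 2 n + c) ^ c) < complexity (perPoly (Fin n) ℝ≥0 * h) := by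
  intro c
  obtain ⟨κ, hκ⟩ := per_fewMonomials_lower_bound
  obtain ⟨T, hT3, hT⟩ := PerFewMonomials.exists_T c κ
  refine ⟨2 ^ T, fun n hn h hh hK => ?_⟩
  set t := Nat.log 2 n with ht
  have hn0 : n ≠ 0 := by
    have : 1 ≤ 2 ^ T := Nat.one_le_two_pow
    omega
  have htT : T ≤ t := by
    have := Nat.log_mono_right (b := 2) hn
    rwa [Nat.log_pow (by norm_num)] at this
  have h2t : 2 ^ t ≤ n := Nat.pow_log_le_self 2 hn0
  have hlt : n < 2 ^ (t + 1) := Nat.lt_pow_succ_log_self (by norm_num) n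
  have hgrow := hT t htT
  -- the main inequality
  have h8 : 8 ≤ n := le_trans (by
    calc 8 = 2 ^ 3 := by norm_num
      _ ≤ 2 ^ T := Nat.pow_le_pow_right (by norm_num) hT3) hn
  have hmain := hκ n h hh (by omega)
  by_contra hle
  push Not at hle
  -- upper bound on the engine quantity
  have hq : ((n + 2) * (complexity (perPoly (Fin n) ℝ≥0 * h) + 3)) ^ κ ≤
      2 ^ (κ * (t + 4 + (t + c) ^ c)) := by
    have e1 : n + 2 ≤ 2 ^ (t + 2) := by
      have : 2 ^ (t + 2) = 2 ^ (t + 1) * 2 := by rw [pow_succ]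
      omega
    have e2 : complexity (perPoly (Fin n) ℝ≥0 * h) + 3 ≤ 2 ^ ((t + c) ^ c + 2) := by
      have : 2 ^ ((t + c) ^ c + 2) = 2 ^ ((t + c) ^ c) * 4 := by rw [pow_add]; norm_num
      have h1 : 1 ≤ 2 ^ ((t + c) ^ c) := Nat.one_le_two_pow
      omega
    calc ((n + 2) * (complexity (perPoly (Fin n) ℝ≥0 * h) + 3)) ^ κ
        ≤ (2 ^ (t + 2) * 2 ^ ((t + c) ^ c + 2)) ^ κ := Nat.pow_le_pow_left (Nat.mul_le_mul e1 e2) κ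
      _ = 2 ^ (κ * (t + 4 + (t + c) ^ c)) := by rw [← pow_add, ← pow_mul]; congr 1; ring
  -- lower bound on the exponent
  have hexp : κ * (t + 4 + (t + c) ^ c) < (n + 2 - 2 * h.support.card) / 3 := by
    have h1 : κ * (t + 4 + (t + c) ^ c) + 1 ≤ n / 6 := by
      have : 6 * (κ * (t + 4 + (t + c) ^ c) + 1) ≤ n := by
        calc 6 * (κ * (t + 4 + (t + c) ^ c) + 1) = 6 * κ * (t + 4 + (t + c) ^ c) + 6 := by ring
          _ ≤ 2 ^ t := hgrow
          _ ≤ n := h2t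
      omega
    omega
  have := calc 2 ^ ((n + 2 - 2 * h.support.card) / 3)
      ≤ ((n + 2) * (complexity (perPoly (Fin n) ℝ≥0 * h) + 3)) ^ κ := hmain
    _ ≤ 2 ^ (κ * (t + 4 + (t + c) ^ c)) := hq
  have := (Nat.pow_le_pow_iff_right (by norm_num : 1 < 2)).1 this
  omega

/-- **`PerDivisionHard` for denominators with few monomials** (the charged form follows a fortiori).
[cite: JerrumSnir1982, §4.3 and Cor. 3.5] [cite: JuknaSeiwertSergeev2022, Lemma 2] -/
theorem perDivisionHard_fewMonomials : ∀ c : ℕ, ∃ n₀ : ℕ, ∀ n ≥ n₀,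
    ∀ h : MvPolynomial (Fin n × Fin n) ℝ≥0, h ≠ 0 → 4 * h.support.card ≤ n →
      2 ^ ((Nat.log 2 n + c) ^ c) <
        complexity (perPoly (Fin n) ℝ≥0 * h) + complexity h := by
  intro c
  obtain ⟨n₀, H⟩ := perMultiplesHard_fewMonomials c
  exact ⟨n₀, fun n hn h hh hK => (H n hn h hh hK).trans_le (Nat.le_add_right _ _)⟩

end Summit.ValiantsHypothesis.ValiantsHypothesis.Theorems.DivisionGapZeroOneTransfer

end
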